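import Summits.Ventures.LatticeQCDFlow.Exactness.Phi4HMCPolyObs
import Summits.Ventures.LatticeQCDFlow.Exactness.Phi4MetropolisActionCSD
import HarnessLib

/-!
# The random-scan Metropolis operator on polynomial-envelope observables, for step laws with moments (window or Gaussian)

HONEST FRAMING: exact (Metropolis-corrected) sampling algorithms for lattice gauge theory;
figures of merit are autocorrelation/cost numbers at stated couplings and volumes; no
continuum-physics claim.  (SCALAR calibration rung S0-A: not a gauge result.)

Venture `LatticeQCDFlow` (cell pub-lqcd), topic `Exactness`; FANOUT row 2 (`s0-phi4`, LOCAL arm;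
gen-13's leftover (α″): the magnetisation ITSELF under step laws of unbounded support, and the road to
the unclipped action).  NEW WORK of the cell over row 2's `metroSite` / `metroScan`
(`Phi4LocalMetropolisExact`, `Phi4MetropolisScan`) and the class `PolyObs` of `Phi4HMCPolyObs`
(`|f φ| ≤ B (1 + Σ_w φ_w²)^k`; contains `M`, `S`, every polynomial; products integrable against
`e^{−S}`).  Gen-13's `Phi4MetropolisScanEnvelope` did this for the quadratic class and the WINDOW
`U[−δ, δ]` only; here the class is `PolyObs` and the step law is ANY density with all moments
(`∫ (1 + |u|)^j ρ(u) du < ∞` for every `j`: the window, Gaussian steps, …).  Nothing is cited as a fact.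

## What is proved (`Λ = Fin (n+1)`, `env φ = 1 + Σ_w φ_w²`)

* `env_update_eq`, **`env_update_le`** — a single-site move by `u` grows the envelope by at most
  `(1 + |u|)²`: `env(φ|φ_x := φ_x + u) ≤ (1 + |u|)² env(φ)`; `env_update_pow_le`;
* `gibbsWeight_le_exp`, **`integrable_proposalWeight`** — `φ ↦ ∫ e^{−S(φ|φ_x:=t')} ρ(t'−φ_x) dt'` is
  integrable on `ℝ^Λ` (one Fubini along the coordinate line; used by `Phi4MetropolisActionSelfCSD`);
* `integrable_metroSite_integrand_poly`, **`abs_metroSite_le_poly`** —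
  `|M_x f(φ)| ≤ B μ_{2k} env(φ)^k`, `μ_j = ∫ (1 + |u|)^j ρ(u) du`; **`polyObs_metroSite`**,
  **`polyObs_metroScan`** ((stab)); **`metroSite_add_mul_poly`**, **`metroScan_add_mul_poly`** ((lin)).

(symm) / (contr) on the class (by clipping + dominated convergence from the bounded case) are
`Exactness/Phi4MetropolisPolyObsDCT.lean`; the floor for `M` itself under any such step law is
`Exactness/Phi4MetropolisMagnetisationMomentCSD.lean`.
-/

namespace Summit.Ventures.LatticeQCDFlow.Exactness

open Real MeasureTheory Filter Finset
open Summit.Ventures.LatticeQCDFlow.Scoring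

section MetropolisPoly

variable {n : ℕ}

/-- The envelope after a single-site update: `env(φ|φ_x:=t') = env(φ) − φ_x² + t'²`. -/
theorem env_update_eq (φ : Fin (n + 1) → ℝ) (x : Fin (n + 1)) (t' : ℝ) :
    1 + ∑ w, Function.update φ x t' w ^ 2 = (1 + ∑ w, φ w ^ 2) - φ x ^ 2 + t' ^ 2 := by
  have e1 : ∑ w, Function.update φ x t' w ^ 2 = t' ^ 2 + ∑ w ∈ Finset.univ \ {x}, φ w ^ 2 := by
    have e : ∀ w, Function.update φ x t' w ^ 2 = Function.update (fun k => φ k ^ 2) x (t' ^ 2) w :=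
      fun w => Function.apply_update (fun _ a => a ^ 2) φ x t' w
    rw [Finset.sum_congr rfl fun w _ => e w, Finset.sum_update_of_mem (Finset.mem_univ x)]
  have e2 : ∑ w, φ w ^ 2 = φ x ^ 2 + ∑ w ∈ Finset.univ \ {x}, φ w ^ 2 :=
    Finset.sum_eq_add_sum_sdiff_singleton_of_mem (Finset.mem_univ x) fun k => φ k ^ 2
  rw [e1, e2]
  ring

/-- **A single-site move grows the envelope by at most `(1 + |u|)²`**:
`env(φ|φ_x:=t') ≤ (1 + |t' − φ_x|)² env(φ)`. -/
theorem env_update_le (φ : Fin (n + 1) → ℝ) (x : Fin (n + 1)) (t' : ℝ) :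
    1 + ∑ w, Function.update φ x t' w ^ 2 ≤ (1 + |t' - φ x|) ^ 2 * (1 + ∑ w, φ w ^ 2) := by
  rw [env_update_eq]
  set u := t' - φ x with hu
  have ht : t' = φ x + u := by rw [hu]; ring
  have henv1 := one_le_env φ
  have hx : |φ x| ≤ 1 + ∑ w, φ w ^ 2 := by
    have h1 : |φ x| ≤ 1 + φ x ^ 2 := by
      nlinarith [abs_nonneg (φ x), sq_abs (φ x), sq_nonneg (|φ x| - 1)]
    have h2 : φ x ^ 2 ≤ ∑ w, φ w ^ 2 :=
      Finset.single_le_sum (fun w _ => sq_nonneg (φ w)) (Finset.mem_univ x)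
    linarith
  rw [ht]
  have hxu : φ x * u ≤ |φ x| * |u| := by
    rw [← abs_mul]; exact le_abs_self _
  have h1 : φ x * u ≤ (1 + ∑ w, φ w ^ 2) * |u| :=
    hxu.trans (mul_le_mul_of_nonneg_right hx (abs_nonneg u))
  have h2 : u ^ 2 ≤ u ^ 2 * (1 + ∑ w, φ w ^ 2) := le_mul_of_one_le_right (sq_nonneg u) henv1
  have e1 : (φ x + u) ^ 2 = φ x ^ 2 + 2 * (φ x * u) + u ^ 2 := by ring
  have e2 : (1 + |u|) ^ 2 * (1 + ∑ w, φ w ^ 2)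
      = (1 + ∑ w, φ w ^ 2) + 2 * ((1 + ∑ w, φ w ^ 2) * |u|) + u ^ 2 * (1 + ∑ w, φ w ^ 2) := by
    have : |u| ^ 2 = u ^ 2 := sq_abs u
    nlinarith [this]
  rw [e1, e2]
  linarith

/-- Powers: `env(φ|φ_x:=t')^k ≤ (1 + |t' − φ_x|)^{2k} env(φ)^k`. -/
theorem env_update_pow_le (k : ℕ) (φ : Fin (n + 1) → ℝ) (x : Fin (n + 1)) (t' : ℝ) :
    (1 + ∑ w, Function.update φ x t' w ^ 2) ^ k
      ≤ (1 + |t' - φ x|) ^ (2 * k) * (1 + ∑ w, φ w ^ 2) ^ k := by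
  rw [pow_mul, ← mul_pow]
  exact pow_le_pow_left₀ (zero_le_one.trans (one_le_env _)) (env_update_le φ x t') k

/-- The Metropolis integrand of a polynomial-envelope observable is integrable in the proposal variable,
with the explicit domination `|…| ≤ B env(φ)^k (1 + |t' − φ_x|)^{2k} ρ(t' − φ_x)` (step law with the
moment `∫ (1+|u|)^{2k} ρ`). -/
theorem integrable_metroSite_integrand_poly (J : Fin (n + 1) → Fin (n + 1) → ℝ) (lam : ℝ)
    {ρ : ℝ → ℝ} (hρ0 : ∀ u, 0 ≤ ρ u) (hρm : Measurable ρ) {k : ℕ}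
    (hρk : Integrable (fun u => (1 + |u|) ^ (2 * k) * ρ u)) (x : Fin (n + 1))
    {f : (Fin (n + 1) → ℝ) → ℝ} (hfm : Measurable f) {B : ℝ} (hB : 0 ≤ B)
    (hfb : ∀ φ, |f φ| ≤ B * (1 + ∑ w, φ w ^ 2) ^ k) (φ : Fin (n + 1) → ℝ) :
    Integrable (fun t' => (metroAccept J lam x φ t' * f (Function.update φ x t')
        + (1 - metroAccept J lam x φ t') * f φ) * ρ (t' - φ x))
      ∧ ∀ t', ‖(metroAccept J lam x φ t' * f (Function.update φ x t')
          + (1 - metroAccept J lam x φ t') * f φ) * ρ (t' - φ x)‖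
        ≤ B * (1 + ∑ w, φ w ^ 2) ^ k * ((1 + |t' - φ x|) ^ (2 * k) * ρ (t' - φ x)) := by
  have hρt : Integrable (fun t' => (1 + |t' - φ x|) ^ (2 * k) * ρ (t' - φ x)) :=
    hρk.comp_sub_right (φ x)
  have hw : Measurable (gibbsWeight J lam) := (continuous_gibbsWeight J lam).measurable
  have hupd : Measurable fun t' : ℝ => Function.update φ x t' := measurable_update φ
  have ha : Measurable fun t' => metroAccept J lam x φ t' := by
    unfold metroAccept
    exact measurable_const.min ((hw.comp hupd).div measurable_const)
  have henv0 : 0 ≤ (1 + ∑ w, φ w ^ 2) ^ k := pow_nonneg (zero_le_one.trans (one_le_env φ)) _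
  have hbound : ∀ t', ‖(metroAccept J lam x φ t' * f (Function.update φ x t')
      + (1 - metroAccept J lam x φ t') * f φ) * ρ (t' - φ x)‖
        ≤ B * (1 + ∑ w, φ w ^ 2) ^ k * ((1 + |t' - φ x|) ^ (2 * k) * ρ (t' - φ x)) := by
    intro t'
    rw [Real.norm_eq_abs, abs_mul, abs_of_nonneg (hρ0 _)]
    obtain ⟨ha0, ha1⟩ := metroAccept_nonneg_le J lam x φ t'
    have hm1 : 1 ≤ (1 + |t' - φ x|) ^ (2 * k) := one_le_pow₀ (by linarith [abs_nonneg (t' - φ x)])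
    have hT : B * (1 + ∑ w, φ w ^ 2) ^ k ≤ B * (1 + ∑ w, φ w ^ 2) ^ k * (1 + |t' - φ x|) ^ (2 * k) :=
      le_mul_of_one_le_right (mul_nonneg hB henv0) hm1
    have hf1 : |f (Function.update φ x t')| ≤ B * (1 + ∑ w, φ w ^ 2) ^ k * (1 + |t' - φ x|) ^ (2 * k) := by
      calc |f (Function.update φ x t')| ≤ B * (1 + ∑ w, Function.update φ x t' w ^ 2) ^ k := hfb _
        _ ≤ B * ((1 + |t' - φ x|) ^ (2 * k) * (1 + ∑ w, φ w ^ 2) ^ k) :=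
            mul_le_mul_of_nonneg_left (env_update_pow_le k φ x t') hB
        _ = B * (1 + ∑ w, φ w ^ 2) ^ k * (1 + |t' - φ x|) ^ (2 * k) := by ring
    have hf2 : |f φ| ≤ B * (1 + ∑ w, φ w ^ 2) ^ k * (1 + |t' - φ x|) ^ (2 * k) := (hfb φ).trans hT
    calc |metroAccept J lam x φ t' * f (Function.update φ x t') + (1 - metroAccept J lam x φ t') * f φ|
          * ρ (t' - φ x)
        ≤ (B * (1 + ∑ w, φ w ^ 2) ^ k * (1 + |t' - φ x|) ^ (2 * k)) * ρ (t' - φ x) := by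
          refine mul_le_mul_of_nonneg_right ?_ (hρ0 _)
          calc |metroAccept J lam x φ t' * f (Function.update φ x t') + (1 - metroAccept J lam x φ t') * f φ|
              ≤ |metroAccept J lam x φ t' * f (Function.update φ x t')|
                  + |(1 - metroAccept J lam x φ t') * f φ| := abs_add_le _ _
            _ = metroAccept J lam x φ t' * |f (Function.update φ x t')|
                  + (1 - metroAccept J lam x φ t') * |f φ| := by
                rw [abs_mul, abs_mul, abs_of_nonneg ha0, abs_of_nonneg (sub_nonneg.2 ha1)]
            _ ≤ metroAccept J lam x φ t' * (B * (1 + ∑ w, φ w ^ 2) ^ k * (1 + |t' - φ x|) ^ (2 * k))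
                  + (1 - metroAccept J lam x φ t')
                    * (B * (1 + ∑ w, φ w ^ 2) ^ k * (1 + |t' - φ x|) ^ (2 * k)) :=
                add_le_add (mul_le_mul_of_nonneg_left hf1 ha0)
                  (mul_le_mul_of_nonneg_left hf2 (sub_nonneg.2 ha1))
            _ = B * (1 + ∑ w, φ w ^ 2) ^ k * (1 + |t' - φ x|) ^ (2 * k) := by ring
      _ = B * (1 + ∑ w, φ w ^ 2) ^ k * ((1 + |t' - φ x|) ^ (2 * k) * ρ (t' - φ x)) := by ring
  refine ⟨Integrable.mono' (hρt.const_mul _)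
    (((ha.mul (hfm.comp hupd)).add ((measurable_const.sub ha).mul measurable_const)).mul
      (hρm.comp (measurable_id.sub measurable_const))).aestronglyMeasurable
    (Eventually.of_forall hbound), hbound⟩

/-- **Envelope bound for the hit**: `|M_x f(φ)| ≤ B μ_{2k} env(φ)^k`, `μ_{2k} = ∫ (1+|u|)^{2k} ρ(u) du`. -/
theorem abs_metroSite_le_poly (J : Fin (n + 1) → Fin (n + 1) → ℝ) (lam : ℝ) {ρ : ℝ → ℝ}
    (hρ0 : ∀ u, 0 ≤ ρ u) (hρm : Measurable ρ) {k : ℕ}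
    (hρk : Integrable (fun u => (1 + |u|) ^ (2 * k) * ρ u)) (x : Fin (n + 1))
    {f : (Fin (n + 1) → ℝ) → ℝ} (hfm : Measurable f) {B : ℝ} (hB : 0 ≤ B)
    (hfb : ∀ φ, |f φ| ≤ B * (1 + ∑ w, φ w ^ 2) ^ k) (φ : Fin (n + 1) → ℝ) :
    |metroSite J lam ρ x f φ|
      ≤ B * (∫ u, (1 + |u|) ^ (2 * k) * ρ u) * (1 + ∑ w, φ w ^ 2) ^ k := by
  obtain ⟨-, hbound⟩ := integrable_metroSite_integrand_poly J lam hρ0 hρm hρk x hfm hB hfb φ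
  have hρt : Integrable (fun t' => (1 + |t' - φ x|) ^ (2 * k) * ρ (t' - φ x)) :=
    hρk.comp_sub_right (φ x)
  have h := norm_integral_le_of_norm_le (hρt.const_mul (B * (1 + ∑ w, φ w ^ 2) ^ k))
    (Eventually.of_forall hbound)
  rw [integral_const_mul, integral_sub_right_eq_self (μ := (volume : Measure ℝ))
    (fun u => (1 + |u|) ^ (2 * k) * ρ u) (φ x), Real.norm_eq_abs] at h
  unfold metroSite
  calc _ ≤ B * (1 + ∑ w, φ w ^ 2) ^ k * ∫ u, (1 + |u|) ^ (2 * k) * ρ u := h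
    _ = _ := by ring

/-- **(stab), one site**: the hit maps `PolyObs` to itself (step law with all moments). -/
theorem polyObs_metroSite (J : Fin (n + 1) → Fin (n + 1) → ℝ) (lam : ℝ) {ρ : ℝ → ℝ}
    (hρ0 : ∀ u, 0 ≤ ρ u) (hρm : Measurable ρ)
    (hρmom : ∀ j : ℕ, Integrable (fun u => (1 + |u|) ^ j * ρ u)) (x : Fin (n + 1))
    {f : (Fin (n + 1) → ℝ) → ℝ} (hf : PolyObs f) : PolyObs (metroSite J lam ρ x f) := by
  obtain ⟨hfm, B, k, hfb⟩ := hf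
  exact ⟨(measurable_metroSite J lam hρm x hfm).measurable,
    |B| * ∫ u, (1 + |u|) ^ (2 * k) * ρ u, k,
    fun φ => abs_metroSite_le_poly J lam hρ0 hρm (hρmom (2 * k)) x hfm (abs_nonneg B)
      (abs_le_abs_mul_env hfb) φ⟩

/-- **(stab)**: the random-site scan maps `PolyObs` to itself (step law with all moments). -/
theorem polyObs_metroScan (J : Fin (n + 1) → Fin (n + 1) → ℝ) (lam : ℝ) {ρ : ℝ → ℝ}
    (hρ0 : ∀ u, 0 ≤ ρ u) (hρm : Measurable ρ)
    (hρmom : ∀ j : ℕ, Integrable (fun u => (1 + |u|) ^ j * ρ u))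
    {f : (Fin (n + 1) → ℝ) → ℝ} (hf : PolyObs f) : PolyObs (metroScan J lam ρ f) := by
  obtain ⟨hfm, B, k, hfb⟩ := hf
  have hn : (0 : ℝ) < (n : ℝ) + 1 := by positivity
  set μk := ∫ u, (1 + |u|) ^ (2 * k) * ρ u with hμk
  refine ⟨?_, |B| * μk, k, fun φ => ?_⟩
  · unfold metroScan
    exact (Finset.measurable_sum _ fun x _ =>
      (measurable_metroSite J lam hρm x hfm).measurable).div_const _
  · unfold metroScan
    rw [abs_div, abs_of_pos hn, div_le_iff₀ hn]
    calc |∑ x, metroSite J lam ρ x f φ| ≤ ∑ x, |metroSite J lam ρ x f φ| :=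
          Finset.abs_sum_le_sum_abs _ _
      _ ≤ ∑ _x : Fin (n + 1), |B| * μk * (1 + ∑ w, φ w ^ 2) ^ k :=
          Finset.sum_le_sum fun x _ => abs_metroSite_le_poly J lam hρ0 hρm (hρmom (2 * k)) x hfm
            (abs_nonneg B) (abs_le_abs_mul_env hfb) φ
      _ = |B| * μk * (1 + ∑ w, φ w ^ 2) ^ k * ((n : ℝ) + 1) := by
          rw [Finset.sum_const, Finset.card_univ, Fintype.card_fin, nsmul_eq_mul]
          push_cast
          ring

/-- **(lin), one site**: the hit is linear on `PolyObs`. -/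
theorem metroSite_add_mul_poly (J : Fin (n + 1) → Fin (n + 1) → ℝ) (lam : ℝ) {ρ : ℝ → ℝ}
    (hρ0 : ∀ u, 0 ≤ ρ u) (hρm : Measurable ρ)
    (hρmom : ∀ j : ℕ, Integrable (fun u => (1 + |u|) ^ j * ρ u)) (x : Fin (n + 1))
    {f h : (Fin (n + 1) → ℝ) → ℝ} (hf : PolyObs f) (hh : PolyObs h) (c : ℝ) (φ : Fin (n + 1) → ℝ) :
    metroSite J lam ρ x (fun s => f s + c * h s) φ
      = metroSite J lam ρ x f φ + c * metroSite J lam ρ x h φ := by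
  obtain ⟨hfm, Bf, kf, hfb⟩ := hf
  obtain ⟨hhm, Bh, kh, hhb⟩ := hh
  unfold metroSite
  have hIf := (integrable_metroSite_integrand_poly J lam hρ0 hρm (hρmom (2 * kf)) x hfm
    (abs_nonneg Bf) (abs_le_abs_mul_env hfb) φ).1
  have hIh := (integrable_metroSite_integrand_poly J lam hρ0 hρm (hρmom (2 * kh)) x hhm
    (abs_nonneg Bh) (abs_le_abs_mul_env hhb) φ).1
  have e : ∀ t', (metroAccept J lam x φ t' * (f (Function.update φ x t') + c * h (Function.update φ x t'))
      + (1 - metroAccept J lam x φ t') * (f φ + c * h φ)) * ρ (t' - φ x)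
      = (metroAccept J lam x φ t' * f (Function.update φ x t')
          + (1 - metroAccept J lam x φ t') * f φ) * ρ (t' - φ x)
        + c * ((metroAccept J lam x φ t' * h (Function.update φ x t')
          + (1 - metroAccept J lam x φ t') * h φ) * ρ (t' - φ x)) := fun t' => by ring
  simp_rw [e]
  rw [integral_add hIf (hIh.const_mul c), integral_const_mul]

/-- **(lin)**: the random-site scan is linear on `PolyObs`. -/
theorem metroScan_add_mul_poly (J : Fin (n + 1) → Fin (n + 1) → ℝ) (lam : ℝ) {ρ : ℝ → ℝ}
    (hρ0 : ∀ u, 0 ≤ ρ u) (hρm : Measurable ρ)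
    (hρmom : ∀ j : ℕ, Integrable (fun u => (1 + |u|) ^ j * ρ u))
    {f h : (Fin (n + 1) → ℝ) → ℝ} (hf : PolyObs f) (hh : PolyObs h) (c : ℝ) (φ : Fin (n + 1) → ℝ) :
    metroScan J lam ρ (fun s => f s + c * h s) φ = metroScan J lam ρ f φ + c * metroScan J lam ρ h φ := by
  unfold metroScan
  rw [Finset.sum_congr rfl fun x _ => metroSite_add_mul_poly J lam hρ0 hρm hρmom x hf hh c φ,
    Finset.sum_add_distrib, ← Finset.mul_sum, add_div, mul_div_assoc]

/-- **The window has all moments**: if `ρ` vanishes outside `[−δ, δ]` and is integrable,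
then `∫ (1+|u|)^j ρ` exists for every `j` (it is `≤ (1+δ)^j ∫ρ`). -/
theorem window_moments {ρ : ℝ → ℝ} (hρ0 : ∀ u, 0 ≤ ρ u) (hρm : Measurable ρ) (hρi : Integrable ρ)
    {δ : ℝ} (hρδ : ∀ u, δ < |u| → ρ u = 0) (j : ℕ) :
    Integrable (fun u => (1 + |u|) ^ j * ρ u) := by
  refine Integrable.mono' (hρi.const_mul ((1 + δ) ^ j))
    (((measurable_const.add (measurable_id.abs)).pow_const j).mul hρm).aestronglyMeasurable
    (Eventually.of_forall fun u => ?_)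
  rw [Real.norm_eq_abs, abs_mul, abs_of_nonneg (hρ0 u), abs_of_nonneg (by positivity)]
  by_cases hz : ρ u = 0
  · simp [hz]
  · have hu : |u| ≤ δ := by
      by_contra h
      exact hz (hρδ _ (lt_of_not_ge h))
    exact mul_le_mul_of_nonneg_right
      (pow_le_pow_left₀ (by positivity) (by linarith) j) (hρ0 u)

/-! ## The proposal-averaged weight (used by the unclipped energy floor) -/

/-- Under coercivity (`ε > 0`) the Gibbs weight is bounded: `e^{−S} ≤ e^{K}`. -/
theorem gibbsWeight_le_exp {J : Fin (n + 1) → Fin (n + 1) → ℝ} {lam ε K : ℝ} (hε : 0 < ε)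
    (hS : ∀ φ : Fin (n + 1) → ℝ, ε * ∑ w, φ w ^ 2 - K ≤ latticePhi4Action J lam φ)
    (φ : Fin (n + 1) → ℝ) : gibbsWeight J lam φ ≤ Real.exp K := by
  unfold gibbsWeight
  apply Real.exp_le_exp.mpr
  have h := hS φ
  have h0 : 0 ≤ ε * ∑ w, φ w ^ 2 := mul_nonneg hε.le (sum_nonneg fun _ _ => sq_nonneg _)
  linarith

/-- **The proposal-averaged weight is integrable**: `φ ↦ ∫ e^{−S(φ|φ_x:=t')} ρ(t' − φ_x) dt'` is in
`L¹(ℝ^Λ)` (its integral is `Z`: one Fubini along the `x`-line, `integral_integral_weight_shift`). -/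
theorem integrable_proposalWeight {J : Fin (n + 1) → Fin (n + 1) → ℝ} {lam ε K : ℝ} (hε : 0 < ε)
    (hS : ∀ φ : Fin (n + 1) → ℝ, ε * ∑ w, φ w ^ 2 - K ≤ latticePhi4Action J lam φ)
    {ρ : ℝ → ℝ} (hρ0 : ∀ u, 0 ≤ ρ u) (hρm : Measurable ρ) (hρi : Integrable ρ)
    (hρ1 : ∫ u, ρ u = 1) (hρs : ∀ u, ρ (-u) = ρ u) (x : Fin (n + 1)) :
    Integrable (fun φ : Fin (n + 1) → ℝ =>
      ∫ t', gibbsWeight J lam (Function.update φ x t') * ρ (t' - φ x)) := by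
  have hw_int : Integrable (gibbsWeight J lam) := integrable_gibbsWeight_of_coercive hε hS
  have hw : Measurable (gibbsWeight J lam) := (continuous_gibbsWeight J lam).measurable
  have hupd : Measurable fun p : (Fin (n + 1) → ℝ) × ℝ => Function.update p.1 x p.2 :=
    measurable_update'
  have hWm : Measurable fun p : (Fin (n + 1) → ℝ) × ℝ =>
      gibbsWeight J lam (Function.update p.1 x p.2) * ρ (p.2 - p.1 x) :=
    (hw.comp hupd).mul (hρm.comp (measurable_snd.sub ((measurable_pi_apply x).comp measurable_fst)))
  have hGm : Measurable fun φ : Fin (n + 1) → ℝ =>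
      ∫ t', gibbsWeight J lam (Function.update φ x t') * ρ (t' - φ x) :=
    hWm.stronglyMeasurable.integral_prod_right'.measurable
  set e := MeasurableEquiv.piFinSuccAbove (fun _ : Fin (n + 1) => ℝ) x with he
  have hmp : MeasurePreserving e := volume_preserving_piFinSuccAbove (fun _ : Fin (n + 1) => ℝ) x
  have hline : ∀ (x' : Fin n → ℝ) (t : ℝ),
      (∫ t', gibbsWeight J lam (Function.update (Fin.insertNth x t x' : Fin (n + 1) → ℝ) x t')
          * ρ (t' - (Fin.insertNth x t x' : Fin (n + 1) → ℝ) x))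
        = ∫ t', gibbsWeight J lam (Fin.insertNth x t' x') * ρ (t' - t) := by
    intro x' t
    refine integral_congr_ae (Eventually.of_forall fun t' => ?_)
    dsimp only
    rw [insertNth_eq_update x t x', Function.update_idem, Function.update_self,
      ← insertNth_eq_update x t' x']
  have hfun : ∀ x' : Fin n → ℝ, (fun t : ℝ => gibbsWeight J lam (Fin.insertNth x t x'))
      = fun t => gibbsWeight J lam (Function.update (Fin.insertNth x (0 : ℝ) x') x t) := by
    intro x'
    funext t
    rw [insertNth_eq_update x t x']
  have hlineW : ∀ x' : Fin n → ℝ,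
      Integrable (fun t : ℝ => gibbsWeight J lam (Fin.insertNth x t x')) := by
    intro x'
    rw [hfun x']
    exact integrable_gibbsWeight_line hε hS (Fin.insertNth x (0 : ℝ) x') x (by simp)
  have hlineWm : ∀ x' : Fin n → ℝ, Measurable (fun t : ℝ => gibbsWeight J lam (Fin.insertNth x t x')) := by
    intro x'
    rw [hfun x']
    exact hw.comp (measurable_update _)
  have hF : Integrable (fun z : ℝ × (Fin n → ℝ) =>
      ∫ t', gibbsWeight J lam (Function.update (e.symm z) x t') * ρ (t' - (e.symm z) x))
      ((volume : Measure ℝ).prod (volume : Measure (Fin n → ℝ))) := by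
    have hmeas : AEStronglyMeasurable (fun z : ℝ × (Fin n → ℝ) =>
        ∫ t', gibbsWeight J lam (Function.update (e.symm z) x t') * ρ (t' - (e.symm z) x))
        ((volume : Measure ℝ).prod (volume : Measure (Fin n → ℝ))) :=
      (hGm.comp e.symm.measurable).aestronglyMeasurable
    rw [integrable_prod_iff' hmeas]
    constructor
    · refine Eventually.of_forall fun x' => ?_
      have hQ := (integrable_weight_shift (hlineWm x') (hlineW x') (fun t => (gibbsWeight_pos J lam _).le)
        hρm hρi hρ0 hρ1 hρs).integral_prod_left
      refine hQ.congr (Eventually.of_forall fun t => ?_)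
      show (∫ t', gibbsWeight J lam (Fin.insertNth x t' x') * ρ (t' - t))
        = ∫ t', gibbsWeight J lam (Function.update (e.symm (t, x')) x t') * ρ (t' - (e.symm (t, x')) x)
      exact (hline x' t).symm
    · have hL := integrable_lineIntegral x hw_int
      refine hL.congr (Eventually.of_forall fun x' => ?_)
      dsimp only
      have e1 : ∀ t : ℝ, ‖∫ t', gibbsWeight J lam (Function.update (e.symm (t, x')) x t')
          * ρ (t' - (e.symm (t, x')) x)‖
          = ∫ t', gibbsWeight J lam (Fin.insertNth x t' x') * ρ (t' - t) := by
        intro t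
        have h := hline x' t
        rw [show (e.symm (t, x') : Fin (n + 1) → ℝ) = Fin.insertNth x t x' from rfl, h,
          Real.norm_eq_abs, abs_of_nonneg]
        exact integral_nonneg fun t' => mul_nonneg (gibbsWeight_pos J lam _).le (hρ0 _)
      simp_rw [e1]
      exact (integral_integral_weight_shift (hlineWm x') (hlineW x')
        (fun t => (gibbsWeight_pos J lam _).le) hρm hρi hρ0 hρ1 hρs).symm
  have hF' : Integrable ((fun φ : Fin (n + 1) → ℝ =>
      ∫ t', gibbsWeight J lam (Function.update φ x t') * ρ (t' - φ x)) ∘ e.symm)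
      (volume : Measure (ℝ × (Fin n → ℝ))) := hF
  exact ((hmp.symm e).integrable_comp_emb e.symm.measurableEmbedding).mp hF'

end MetropolisPoly

end Summit.Ventures.LatticeQCDFlow.Exactness
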